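import Literature.Analysis.FluidPDE.FracNSGalerkinLimit
import HarnessLib

/-!
# Fractional Navier–Stokes on `T^d`: the Galerkin approximations exist, and the assembly of
  Leray's existence theorem (discharge of `fracGalerkin_scheme_exists` and of
  `ColomboDeLellisDeRosa2018_thm11`)

Analysis/FluidPDE. Closing module of the proof of Leray's existence theorem for the fractional
Navier–Stokes system `∂ₜv + div(v ⊗ v) + ∇p + (-Δ)^α v = 0`, `div v = 0` on the flat torus
(Colombo–De Lellis–De Rosa 2018, Thm. 1.1 with the remark following it; proof in §9, p. 20 of the
held arXiv text), along the decomposition of `Literature/Analysis/FluidPDE/FracNSGalerkin`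
(`fracGalerkin_scheme_exists` + `fracGalerkin_limit` ⇒ `ColomboDeLellisDeRosa2018_thm11`,
`ColomboDeLellisDeRosa2018_thm11_of_fracGalerkin`). The second half, `fracGalerkin_limit_holds`,
is `Literature/Analysis/FluidPDE/FracNSGalerkinLimit`; this module supplies the first half and
the assembly, exactly as the tree's `α = 1` development does in `NSHopfGalerkinExistence`
(Part 3, `exists_isHopfGalerkinScheme`):

* `exists_isFracGalerkinScheme` — **the fractional Galerkin approximations exist** in every
  dimension and for every `α > 0` (CDLDR §9, first half: the truncated problems (NS_reg) are
  globally solvable ODEs obeying the exact energy identity): orders `N n = n`, fields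
  `U n = realTrigPoly (freqBall n) (β n ·)` with `β n` the global solution of the `n`-th
  fractional Galerkin ODE from the datum `(û₀(k))_{|k| ≤ n}` (`exists_fracGalerkin_solution`,
  `fracGalerkin_test_identity`, `fracGalerkin_energy_identity` of `FracNSGalerkinExistence`), the
  datum clause being `U n 0 = P_n u₀ → u₀` in `L²` (`Torus.fourierTruncate`);
* `Torus.exists_isLerayFracSolution` — **Leray's existence theorem for the fractional system on
  `T^d`, every `d`, every `α > 0`**: every weakly divergence-free `u₀ ∈ L²` is the datum of a
  Leray solution `Torus.IsLerayFracSolution α u₀ u` (the scheme exists, and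
  `IsFracGalerkinScheme.exists_isLerayFracSolution` of `FracNSGalerkinLimit` extracts a Leray
  limit);
* the named facts on `𝕋³`: `fracGalerkin_scheme_exists_holds : fracGalerkin_scheme_exists`
  and `ColomboDeLellisDeRosa2018_thm11_holds : ColomboDeLellisDeRosa2018_thm11`
  (`Literature/Analysis/FluidPDE/FractionalNSPrescribedEnergy`; Colombo–De Lellis–De Rosa 2018,
  Thm. 1.1), the latter literally by `ColomboDeLellisDeRosa2018_thm11_of_fracGalerkin`.

The printed range of exponents is `α ∈ ]0,1[` (CDLDR 2018, §1); the Galerkin argument uses only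
`α > 0`, and the general-dimension theorems are stated in that generality (the named facts keep
the printed hypotheses `0 < α < 1`, the upper bound being unused).

Theorem-only module (no definitions).

## References

* M. Colombo, C. De Lellis, L. De Rosa, *Ill-posedness of Leray solutions for the hypodissipative
  Navier–Stokes equations*, Comm. Math. Phys. 362 (2018), 659–688 (held: arXiv:1708.05666), §1
  Thm. 1.1 with (2)–(3) and the weak formulation (p. 3), §9 (proof of Thm. 1.1, p. 20).
  [`ColomboDelellisDerosa2018`]
* J. C. Robinson, J. L. Rodrigo, W. Sadowski, *The three-dimensional Navier–Stokes equations*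
  (CUP 2016), Thm. 4.4 Steps 1–2 (the `α = 1` template followed by the tree).
  [`RobinsonRodrigoSadowski2016`]
* E. Hopf, *Über die Anfangswertaufgabe für die hydrodynamischen Grundgleichungen*, Math. Nachr.
  4 (1951), 213–231, §§2–3 (the method). [`Hopf1951`]
-/

noncomputable section

open MeasureTheory TopologicalSpace Set Function Filter Topology UnitAddTorus
open scoped InnerProductSpace RealInnerProductSpace ENNReal NNReal

namespace Literature.Analysis.FluidPDE

variable {d : Type*} [Fintype d] [DecidableEq d]

/-! ## The fractional Galerkin approximations exist (every dimension, every `α > 0`) -/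

section SchemeExists

open FunctionSpaces.Torus Torus

/-- **Existence of a fractional Galerkin scheme** in every dimension (Colombo–De Lellis–De Rosa
2018, §9, first half of the proof of Thm. 1.1, p. 20: the truncated problems (NS_reg)
`∂ₜw + div P_K(w ⊗ w) + ∇q + (-Δ)^α w = 0`, `w(0) = P_K v̄` "reduce to a system of ordinary
differential equations for the Fourier coefficients … by a standard continuation argument … a
global solution on `ℝ⁺`"). Let `α > 0` and `u₀ ∈ L²(T^d; ℝ^d)` be weakly divergence free. With
`N n = n` and `U n = realTrigPoly (freqBall n) (β n ·)`, `β n` the global solution of the `n`-th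
fractional Galerkin ODE from the datum `(û₀(k))_{|k| ≤ n}` (`exists_fracGalerkin_solution`), the
pair `(N, U)` is a fractional Galerkin scheme for `(α, u₀)`: the tested equations are
`fracGalerkin_test_identity`, the energy identity is `fracGalerkin_energy_identity`, and the
datum is the Fourier truncation `U n 0 = P_n u₀ → u₀` in `L²`
(`Torus.integral_inner_fourierTruncate_eq`, `Torus.tendsto_eLpNorm_fourierTruncate_sub`).
[cite: ColomboDelellisDerosa2018, §9 (proof of Thm. 1.1), (NS_reg)] -/
theorem exists_isFracGalerkinScheme (α : ℝ) (hα : 0 < α)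
    (u₀ : UnitAddTorus d → EuclideanSpace ℝ d) (hu₀ : MemLp u₀ 2 volume)
    (hdiv : FunctionSpaces.Torus.IsWeaklyDivFree u₀) :
    ∃ (N : ℕ → ℕ) (U : ℕ → ℝ → UnitAddTorus d → EuclideanSpace ℝ d),
      IsFracGalerkinScheme α u₀ N U := by
  have hS : ∀ n : ℕ, ∀ k ∈ freqBall (d := d) n, -k ∈ freqBall n := fun n =>
    neg_mem_freqBall_of_mem
  -- the data of the Galerkin systems: `(û₀(k))_{|k| ≤ n}`
  set c₀ : (n : ℕ) → ↥(freqBall (d := d) n) → EuclideanSpace ℂ d :=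
    fun n k => mFourierCoeff (FunctionSpaces.EuclideanSpace.complexify ∘ u₀) k with hc₀_def
  have hc₀ : ∀ n, c₀ n ∈ galerkinSubspace (freqBall (d := d) n) := fun n =>
    ⟨isRealCoeff_mFourierCoeff (hu₀.integrable one_le_two),
      isSolenoidalCoeff_restrict (hdiv.isTransversal_mFourierCoeff hu₀ (freqBall n))⟩
  -- the global solutions of the fractional Galerkin ODEs
  have hsol : ∀ n : ℕ, ∃ β : ℝ → ↥(freqBall (d := d) n) → EuclideanSpace ℂ d,
      β 0 = c₀ n ∧ (∀ t, β t ∈ galerkinSubspace (freqBall n)) ∧ Continuous β ∧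
      ∀ T, ∀ t ∈ Icc 0 T, HasDerivWithinAt β
        (galerkinRHS (freqBall n) 0
          (fun k : ↥(freqBall n) => -((((fracSymbol α (k : d → ℤ)) : ℝ) : ℂ) • β t k)) (β t))
        (Icc 0 T) t := fun n =>
    exists_fracGalerkin_solution α (hS n) (hc₀ n)
  choose β hβ0 hβmem hβcont hβderiv using hsol
  -- the scheme
  refine ⟨id, fun n t => realTrigPoly (freqBall n) (coeffExt (freqBall n) (β n t)), ?_⟩
  -- the datum is the Fourier truncation
  have hU0 : ∀ n, realTrigPoly (freqBall n) (coeffExt (freqBall n) (β n 0)) =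
      fourierTruncate n u₀ := by
    intro n
    rw [hβ0 n, fourierTruncate_eq]
    exact realTrigPoly_coeffExt_restrict _
  -- band-limitation of Galerkin modes in `Finset` form
  have hband : ∀ {n : ℕ} {a : UnitAddTorus d → EuclideanSpace ℝ d}, IsGalerkinMode n a →
      ∀ k ∉ freqBall (d := d) n,
        mFourierCoeff (FunctionSpaces.EuclideanSpace.complexify ∘ a) k = 0 :=
    fun ha k hk => ha.mFourierCoeff_eq_zero (not_mem_freqBall.1 hk)
  exact
    { tendsto_order := tendsto_id
      continuousOn := fun n => continuousOn_stLift_realTrigPoly (hβcont n).continuousOn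
      isGalerkinMode := fun n t _ =>
        have h := galerkin_slice_props (hS n) (hβmem n t)
        ⟨h.1, h.2.1, fun k hk => h.2.2.2 k (not_mem_freqBall.2 hk)⟩
      isWeaklyDivFree := fun n t _ => (galerkin_slice_props (hS n) (hβmem n t)).2.2.1
      galerkin := fun n a ha s t hs hst =>
        fracGalerkin_test_identity hα.le (hS n) (hβcont n) (hβmem n) (hβderiv n)
          ha.isSmooth ha.isDivFree (hband ha) hs hst
      energy_eq := fun n s t hs hst =>
        fracGalerkin_energy_identity hα.ne' (hS n) (hβcont n) (hβmem n) (hβderiv n) hs hst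
      initial_inner := fun n a ha => by
        rw [hU0 n]
        exact integral_inner_fourierTruncate_eq hu₀ (ha.isSmooth.memLp 2) (hband ha)
      tendsto_initial := by
        have heq : (fun n => eLpNorm (realTrigPoly (freqBall n) (coeffExt (freqBall n) (β n 0)) -
            u₀) 2 volume) = fun n => eLpNorm (fourierTruncate n u₀ - u₀) 2 volume := by
          funext n; rw [hU0 n]
        rw [heq]
        exact tendsto_eLpNorm_fourierTruncate_sub hu₀ }

end SchemeExists

/-! ## Leray's existence theorem for the fractional system -/

/-- **Leray's existence theorem for the fractional Navier–Stokes system on `T^d`** (every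
dimension `d`, every exponent `α > 0`; Colombo–De Lellis–De Rosa 2018, Thm. 1.1 with the remark
following it, proof §9): every weakly divergence-free `u₀ ∈ L²(T^d; ℝ^d)` is the datum of a Leray
solution `Torus.IsLerayFracSolution α u₀ u` of `∂ₜv + div(v ⊗ v) + ∇p + (-Δ)^α v = 0` — the
Galerkin approximations exist (`exists_isFracGalerkinScheme`) and a subsequence converges to a
Leray solution (`IsFracGalerkinScheme.exists_isLerayFracSolution`, `FracNSGalerkinLimit`).
[cite: ColomboDelellisDerosa2018, §1 Thm. 1.1 and p. 3 (remark on (3)); proof §9] -/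
theorem Torus.exists_isLerayFracSolution {α : ℝ} (hα : 0 < α)
    {u₀ : UnitAddTorus d → EuclideanSpace ℝ d} (hu₀ : MemLp u₀ 2 volume)
    (hdiv : FunctionSpaces.Torus.IsWeaklyDivFree u₀) :
    ∃ u : ℝ → UnitAddTorus d → EuclideanSpace ℝ d, Torus.IsLerayFracSolution α u₀ u := by
  obtain ⟨N, U, hS⟩ := exists_isFracGalerkinScheme α hα u₀ hu₀ hdiv
  exact hS.exists_isLerayFracSolution hα hu₀ hdiv

/-! ## The named facts on `𝕋³` -/

/-- **Discharge of `fracGalerkin_scheme_exists`** (Colombo–De Lellis–De Rosa 2018, §9, first half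
of the proof of Thm. 1.1: (NS_reg) is globally solvable with the energy identity): every weakly
divergence-free `L²` datum on `𝕋³` admits a fractional Galerkin scheme for every `α ∈ ]0,1[`, by
`exists_isFracGalerkinScheme` in dimension `3` (the upper bound on `α` is not used).
[cite: ColomboDelellisDerosa2018, §9 (proof of Thm. 1.1), (NS_reg)] -/
theorem fracGalerkin_scheme_exists_holds : fracGalerkin_scheme_exists :=
  fun α hα _hα1 u₀ hu₀ hdiv => exists_isFracGalerkinScheme α hα u₀ hu₀ hdiv

/-- **Colombo–De Lellis–De Rosa 2018, Thm. 1.1 (with the remark following it) — discharged**: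
for every `α ∈ ]0,1[` and every weakly divergence-free `u₀ ∈ L²(𝕋³)` there is a Leray solution
`Torus.IsLerayFracSolution α u₀ u` of the fractional Navier–Stokes system ("For any `v̄ ∈ L²(𝕋³)`
with `div v̄ = 0` and every `α ∈ ]0,1[` there is a weak solution … (2) … the solution produced
by the proof of Theorem 1.1 can be shown to satisfy … (3) for a.e. `s` and `∀ t > s`", §1 p. 3;
proof §9 p. 20). The named fact `ColomboDeLellisDeRosa2018_thm11` of
`Literature/Analysis/FluidPDE/FractionalNSPrescribedEnergy` holds, by the assembly
`ColomboDeLellisDeRosa2018_thm11_of_fracGalerkin` of `Literature/Analysis/FluidPDE/FracNSGalerkin`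
from its two discharged halves `fracGalerkin_scheme_exists_holds` (this file) and
`fracGalerkin_limit_holds` (`FracNSGalerkinLimit`).
[cite: ColomboDelellisDerosa2018, §1 Thm. 1.1 and p. 3 (remark on (3)); proof §9] -/
theorem ColomboDeLellisDeRosa2018_thm11_holds : ColomboDeLellisDeRosa2018_thm11 :=
  ColomboDeLellisDeRosa2018_thm11_of_fracGalerkin fracGalerkin_scheme_exists_holds
    fracGalerkin_limit_holds

end Literature.Analysis.FluidPDE
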